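import Summits.Ventures.LatticeQCDFlow.Exactness.Phi4HMCTailEnergy
import HarnessLib

/-!
# The leapfrog overshoots the quartic wall, III: every further qpq step flips and CUBES the excursion

HONEST FRAMING: exact (Metropolis-corrected) sampling algorithms for lattice gauge theory;
figures of merit are autocorrelation/cost numbers at stated couplings and volumes; no
continuum-physics claim.  (SCALAR calibration rung S0-A: not a gauge result.)

Venture `LatticeQCDFlow` (cell pub-lqcd), topic `Exactness`; FANOUT row 2 (`s0-phi4`, HMC arm).
NEW WORK of the cell over `Exactness/Phi4HMCTailEnergy.lean` (one step from the far box) and the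
tree's qpq leapfrog (`Scoring/FreeFieldLeapfrog`: `leapfrogQPQ`, `lfDrift`, `lfKick`).  Nothing is
cited as a fact.  Printed counterpart NAMED ONLY: Livingstone–Betancourt–Byrne–Girolami, Bernoulli 25
(2019) Thm 5.13 / Lemmas 5.14–5.15 (`‖x_{Lε}‖ ≥ 2^L ‖x_0‖` far out, under isotropic growth conditions
that the lattice φ⁴ potential violates for `V ≥ 3`); here the lattice version: a COORDINATEWISE stage
invariant that every qpq step propagates, with the sign of the excursion alternating and its size
cubing.

## What is proved (`Λ = Fin (n+1)`, `C_J = Σ_{x,y}|J_{xy}|`, `λ ≥ 0`, `δ > 0`)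

STAGE INVARIANT of a phase-space point `z = (q, p)` with sign `σ = ±1` and levels `(a, A, b, B)`: the
half-drifted position `u = q + (δ/2)p` has `a ≤ σ u_y ≤ A` at every site and the kicked momentum
`p' = p − δF(u)` has `b ≤ −σ p'_y ≤ B` at every site (position and new momentum point in OPPOSITE
directions).

* `latticePhi4Force_mem_of_box` — two-sided force bound on a signed box:
  `a ≤ σ u ≤ A` (`a ≥ 0`) ⇒ `4λa³ − 2 C_J A ≤ σ F_x(u) ≤ 4λA³ + 2 C_J A`;
* **`leapfrogQPQ_stage`** — the invariant PROPAGATES through one qpq step with the sign flipped and the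
  levels mapped by `Φ(a, A, b, B) = (δb − A, δB, δ(4λ(δb − A)³ − 2C_J δB) − B, δ(4λ(δB)³ + 2C_J δB) + B)`
  (as long as `a, b ≥ 0` and `δb − A ≥ 0`);
* **`leapfrogQPQ_stages`** — hence through `k` steps: `leapfrogQPQ^[k] z` satisfies the invariant with
  sign `(−1)^k σ` and levels `Φ^[k](a, A, b, B)`, provided all intermediate levels `a_j, b_j` and
  `δ b_j − A_j` are nonnegative;
* `stage_zero_of_mem_box` — from the far box `A_t = {t ≤ φ_x ≤ 2t}` with `|p_y| ≤ t/δ` and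
  `t/δ + 5δtC_J ≤ δλt³/4` the invariant holds with `σ = +1` and levels
  `(t/2, 5t/2, δλt³/4, t/δ + δ(4λ(5t/2)³ + 2C_J(5t/2)))`.

The growth of the levels in `t` (`a_k ≍ t^{3^k}`, `b_k ≍ t^{3^{k+1}}`) and the `N`-step energy gap /
rejection / no-spectral-gap theorems are `Exactness/Phi4HMCTailRejectionN.lean`.  NOT CLAIMED: the pqp
variant; anything at `λ = 0`.
-/

namespace Summit.Ventures.LatticeQCDFlow.Exactness

open Real MeasureTheory Filter Finset
open Summit.Ventures.LatticeQCDFlow.Scoring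

section Stages

variable {n : ℕ}

/-! ## §1 Two-sided force bound on a signed box -/

/-- **Two-sided force bound**: if `a ≤ σ u_y ≤ A` at every site (`σ = ±1`, `a ≥ 0`, `λ ≥ 0`) then
`4λa³ − 2 C_J A ≤ σ F_x(u) ≤ 4λA³ + 2 C_J A` at every site. -/
theorem latticePhi4Force_mem_of_box {lam a A σ : ℝ} (hlam : 0 ≤ lam) (ha : 0 ≤ a)
    (hσ : σ = 1 ∨ σ = -1) (J : Fin (n + 1) → Fin (n + 1) → ℝ) (u : Fin (n + 1) → ℝ)
    (hu : ∀ y, a ≤ σ * u y ∧ σ * u y ≤ A) (x : Fin (n + 1)) :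
    4 * lam * a ^ 3 - 2 * (∑ x, ∑ y, |J x y|) * A ≤ σ * latticePhi4Force J lam u x ∧
      σ * latticePhi4Force J lam u x ≤ 4 * lam * A ^ 3 + 2 * (∑ x, ∑ y, |J x y|) * A := by
  have hσ2 : σ ^ 2 = 1 := by rcases hσ with h | h <;> rw [h] <;> norm_num
  have hσ3 : ∀ v : ℝ, σ * v ^ 3 = (σ * v) ^ 3 := fun v => by
    have : σ ^ 3 = σ := by rcases hσ with h | h <;> rw [h] <;> norm_num
    rw [mul_pow, this]
  have hA : 0 ≤ A := le_trans ha (le_trans (hu x).1 (hu x).2)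
  -- `σ F_x = Σ_y (J_xy + J_yx)(σ u_y) + 4λ (σ u_x)³`
  have e : σ * latticePhi4Force J lam u x
      = (∑ y, (J x y + J y x) * (σ * u y)) + 4 * lam * (σ * u x) ^ 3 := by
    unfold latticePhi4Force
    rw [mul_add, Finset.mul_sum, ← hσ3]
    congr 1
    · exact Finset.sum_congr rfl fun y _ => by ring
    · ring
  rw [e]
  have hcube_lo : a ^ 3 ≤ (σ * u x) ^ 3 := pow_le_pow_left₀ ha (hu x).1 3
  have hcube_hi : (σ * u x) ^ 3 ≤ A ^ 3 := pow_le_pow_left₀ (le_trans ha (hu x).1) (hu x).2 3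
  have hlin : |∑ y, (J x y + J y x) * (σ * u y)| ≤ 2 * (∑ x, ∑ y, |J x y|) * A := by
    calc |∑ y, (J x y + J y x) * (σ * u y)| ≤ ∑ y, |(J x y + J y x) * (σ * u y)| :=
          Finset.abs_sum_le_sum_abs _ _
      _ ≤ ∑ y, (|J x y| + |J y x|) * A := by
          refine Finset.sum_le_sum fun y _ => ?_
          rw [abs_mul, abs_of_nonneg (le_trans ha (hu y).1)]
          exact mul_le_mul (abs_add_le _ _) (hu y).2 (le_trans ha (hu y).1)
            (add_nonneg (abs_nonneg _) (abs_nonneg _))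
      _ = (∑ y, (|J x y| + |J y x|)) * A := by rw [Finset.sum_mul]
      _ ≤ (2 * ∑ x, ∑ y, |J x y|) * A := mul_le_mul_of_nonneg_right (sum_abs_add_abs_le J x) hA
      _ = 2 * (∑ x, ∑ y, |J x y|) * A := by ring
  have h1 := neg_abs_le (∑ y, (J x y + J y x) * (σ * u y))
  have h2 := le_abs_self (∑ y, (J x y + J y x) * (σ * u y))
  constructor <;> nlinarith

/-! ## §2 One qpq step propagates the stage invariant (sign flips, levels map by `Φ`) -/

/-- The qpq step in terms of the half-drifted position `u = q + (δ/2)p` and the kicked momentum `p'`: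
`leapfrogQPQ (q, p) = (u + (δ/2)p', p')`, and the NEXT half-drifted position is `u + δ p'`. -/
theorem lfDrift_leapfrogQPQ (J : Fin (n + 1) → Fin (n + 1) → ℝ) (lam δ : ℝ)
    (z : (Fin (n + 1) → ℝ) × (Fin (n + 1) → ℝ)) (y : Fin (n + 1)) :
    lfDrift (δ / 2) (leapfrogQPQ J lam δ z).1 (leapfrogQPQ J lam δ z).2 y
      = lfDrift (δ / 2) z.1 z.2 y + δ * lfKick J lam δ (lfDrift (δ / 2) z.1 z.2) z.2 y := by
  simp only [leapfrogQPQ, lfDrift]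
  ring

/-- **ONE STEP PROPAGATES THE INVARIANT.**  `λ ≥ 0`, `δ > 0`, `σ = ±1`, levels `a, b ≥ 0` with
`δb − A ≥ 0`.  If `u = q + (δ/2)p` has `a ≤ σu_y ≤ A` and `p' = p − δF(u)` has `b ≤ −σp'_y ≤ B` at every
site, then after the step (`z' = leapfrogQPQ z`, `u' = u + δp'`, `p'' = p' − δF(u')`):
`δb − A ≤ −σ u'_y ≤ δB` and `δ(4λ(δb − A)³ − 2C_J δB) − B ≤ σ p''_y ≤ δ(4λ(δB)³ + 2C_J δB) + B`. -/
theorem leapfrogQPQ_stage {lam δ σ a A b B : ℝ} (hlam : 0 ≤ lam) (hδ : 0 < δ) (hσ : σ = 1 ∨ σ = -1)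
    (ha : 0 ≤ a) (hb : 0 ≤ b) (ha' : 0 ≤ δ * b - A) (J : Fin (n + 1) → Fin (n + 1) → ℝ)
    (z : (Fin (n + 1) → ℝ) × (Fin (n + 1) → ℝ))
    (hu : ∀ y, a ≤ σ * lfDrift (δ / 2) z.1 z.2 y ∧ σ * lfDrift (δ / 2) z.1 z.2 y ≤ A)
    (hp : ∀ y, b ≤ -σ * lfKick J lam δ (lfDrift (δ / 2) z.1 z.2) z.2 y ∧
      -σ * lfKick J lam δ (lfDrift (δ / 2) z.1 z.2) z.2 y ≤ B) :
    (∀ y, δ * b - A ≤ -σ * lfDrift (δ / 2) (leapfrogQPQ J lam δ z).1 (leapfrogQPQ J lam δ z).2 y ∧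
        -σ * lfDrift (δ / 2) (leapfrogQPQ J lam δ z).1 (leapfrogQPQ J lam δ z).2 y ≤ δ * B) ∧
    (∀ y, δ * (4 * lam * (δ * b - A) ^ 3 - 2 * (∑ x, ∑ y, |J x y|) * (δ * B)) - B
        ≤ -(-σ) * lfKick J lam δ (lfDrift (δ / 2) (leapfrogQPQ J lam δ z).1 (leapfrogQPQ J lam δ z).2)
          (leapfrogQPQ J lam δ z).2 y ∧
      -(-σ) * lfKick J lam δ (lfDrift (δ / 2) (leapfrogQPQ J lam δ z).1 (leapfrogQPQ J lam δ z).2)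
          (leapfrogQPQ J lam δ z).2 y
        ≤ δ * (4 * lam * (δ * B) ^ 3 + 2 * (∑ x, ∑ y, |J x y|) * (δ * B)) + B) := by
  set u := lfDrift (δ / 2) z.1 z.2 with hudef
  set p' := lfKick J lam δ u z.2 with hp'def
  set u' := lfDrift (δ / 2) (leapfrogQPQ J lam δ z).1 (leapfrogQPQ J lam δ z).2 with hu'def
  have hσ' : -σ = 1 ∨ -σ = -1 := by rcases hσ with h | h <;> rw [h] <;> norm_num
  -- the new half-drifted position `u' = u + δ p'`
  have hu'eq : ∀ y, u' y = u y + δ * p' y := fun y => lfDrift_leapfrogQPQ J lam δ z y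
  have hu' : ∀ y, δ * b - A ≤ -σ * u' y ∧ -σ * u' y ≤ δ * B := by
    intro y
    rw [hu'eq y]
    have h1 := hu y
    have h2 := hp y
    have e : -σ * (u y + δ * p' y) = -(σ * u y) + δ * (-σ * p' y) := by ring
    rw [e]
    constructor <;> nlinarith [h1.1, h1.2, h2.1, h2.2, hδ.le]
  refine ⟨hu', fun y => ?_⟩
  -- the new kick: `σ p'' = σ p' − δ σ F(u')`, with `−σ F(u')` in the force box of `u'`
  have hF := latticePhi4Force_mem_of_box hlam ha' hσ' J u' hu' y
  have hp2 : (leapfrogQPQ J lam δ z).2 = p' := by simp only [leapfrogQPQ, hp'def, hudef]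
  have ekick : -(-σ) * lfKick J lam δ u' (leapfrogQPQ J lam δ z).2 y
      = -(-σ * p' y) + δ * (-σ * latticePhi4Force J lam u' y) := by
    rw [hp2]
    unfold lfKick
    ring
  rw [ekick]
  have h2 := hp y
  constructor <;> nlinarith [h2.1, h2.2, hF.1, hF.2, hδ.le]

/-! ## §3 `k` steps: sign `(−1)^k σ`, levels `Φ^[k](a, A, b, B)` -/

/-- **`k` STEPS PROPAGATE THE INVARIANT.**  With the level map
`Φ(a, A, b, B) = (δb − A, δB, δ(4λ(δb − A)³ − 2C_J δB) − B, δ(4λ(δB)³ + 2C_J δB) + B)`: if `z` satisfies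
the stage invariant with sign `σ` and levels `v = (a, A, b, B)`, and along the way all levels
`a_j, b_j, δb_j − A_j` (`j < k`, `(a_j, A_j, b_j, B_j) = Φ^[j] v`) are nonnegative, then
`leapfrogQPQ^[k] z` satisfies it with sign `(−1)^k σ` and levels `Φ^[k] v`. -/
theorem leapfrogQPQ_stages {lam δ : ℝ} (hlam : 0 ≤ lam) (hδ : 0 < δ)
    (J : Fin (n + 1) → Fin (n + 1) → ℝ) (k : ℕ) :
    ∀ {σ : ℝ} (_hσ : σ = 1 ∨ σ = -1) (v : ℝ × ℝ × ℝ × ℝ) (z : (Fin (n + 1) → ℝ) × (Fin (n + 1) → ℝ)),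
      (∀ y, v.1 ≤ σ * lfDrift (δ / 2) z.1 z.2 y ∧ σ * lfDrift (δ / 2) z.1 z.2 y ≤ v.2.1) →
      (∀ y, v.2.2.1 ≤ -σ * lfKick J lam δ (lfDrift (δ / 2) z.1 z.2) z.2 y ∧
        -σ * lfKick J lam δ (lfDrift (δ / 2) z.1 z.2) z.2 y ≤ v.2.2.2) →
      (∀ j, j < k →
        0 ≤ ((fun w : ℝ × ℝ × ℝ × ℝ => (δ * w.2.2.1 - w.2.1, δ * w.2.2.2,
          δ * (4 * lam * (δ * w.2.2.1 - w.2.1) ^ 3 - 2 * (∑ x, ∑ y, |J x y|) * (δ * w.2.2.2)) - w.2.2.2,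
          δ * (4 * lam * (δ * w.2.2.2) ^ 3 + 2 * (∑ x, ∑ y, |J x y|) * (δ * w.2.2.2)) + w.2.2.2))^[j] v).1 ∧
        0 ≤ ((fun w : ℝ × ℝ × ℝ × ℝ => (δ * w.2.2.1 - w.2.1, δ * w.2.2.2,
          δ * (4 * lam * (δ * w.2.2.1 - w.2.1) ^ 3 - 2 * (∑ x, ∑ y, |J x y|) * (δ * w.2.2.2)) - w.2.2.2,
          δ * (4 * lam * (δ * w.2.2.2) ^ 3 + 2 * (∑ x, ∑ y, |J x y|) * (δ * w.2.2.2)) + w.2.2.2))^[j] v).2.2.1 ∧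
        0 ≤ δ * ((fun w : ℝ × ℝ × ℝ × ℝ => (δ * w.2.2.1 - w.2.1, δ * w.2.2.2,
          δ * (4 * lam * (δ * w.2.2.1 - w.2.1) ^ 3 - 2 * (∑ x, ∑ y, |J x y|) * (δ * w.2.2.2)) - w.2.2.2,
          δ * (4 * lam * (δ * w.2.2.2) ^ 3 + 2 * (∑ x, ∑ y, |J x y|) * (δ * w.2.2.2)) + w.2.2.2))^[j] v).2.2.1
          - ((fun w : ℝ × ℝ × ℝ × ℝ => (δ * w.2.2.1 - w.2.1, δ * w.2.2.2,
          δ * (4 * lam * (δ * w.2.2.1 - w.2.1) ^ 3 - 2 * (∑ x, ∑ y, |J x y|) * (δ * w.2.2.2)) - w.2.2.2,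
          δ * (4 * lam * (δ * w.2.2.2) ^ 3 + 2 * (∑ x, ∑ y, |J x y|) * (δ * w.2.2.2)) + w.2.2.2))^[j] v).2.1) →
      (∀ y, ((fun w : ℝ × ℝ × ℝ × ℝ => (δ * w.2.2.1 - w.2.1, δ * w.2.2.2,
          δ * (4 * lam * (δ * w.2.2.1 - w.2.1) ^ 3 - 2 * (∑ x, ∑ y, |J x y|) * (δ * w.2.2.2)) - w.2.2.2,
          δ * (4 * lam * (δ * w.2.2.2) ^ 3 + 2 * (∑ x, ∑ y, |J x y|) * (δ * w.2.2.2)) + w.2.2.2))^[k] v).1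
          ≤ ((-1) ^ k * σ) * lfDrift (δ / 2) ((leapfrogQPQ J lam δ)^[k] z).1 ((leapfrogQPQ J lam δ)^[k] z).2 y ∧
        ((-1) ^ k * σ) * lfDrift (δ / 2) ((leapfrogQPQ J lam δ)^[k] z).1 ((leapfrogQPQ J lam δ)^[k] z).2 y
          ≤ ((fun w : ℝ × ℝ × ℝ × ℝ => (δ * w.2.2.1 - w.2.1, δ * w.2.2.2,
          δ * (4 * lam * (δ * w.2.2.1 - w.2.1) ^ 3 - 2 * (∑ x, ∑ y, |J x y|) * (δ * w.2.2.2)) - w.2.2.2,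
          δ * (4 * lam * (δ * w.2.2.2) ^ 3 + 2 * (∑ x, ∑ y, |J x y|) * (δ * w.2.2.2)) + w.2.2.2))^[k] v).2.1) ∧
      (∀ y, ((fun w : ℝ × ℝ × ℝ × ℝ => (δ * w.2.2.1 - w.2.1, δ * w.2.2.2,
          δ * (4 * lam * (δ * w.2.2.1 - w.2.1) ^ 3 - 2 * (∑ x, ∑ y, |J x y|) * (δ * w.2.2.2)) - w.2.2.2,
          δ * (4 * lam * (δ * w.2.2.2) ^ 3 + 2 * (∑ x, ∑ y, |J x y|) * (δ * w.2.2.2)) + w.2.2.2))^[k] v).2.2.1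
          ≤ -((-1) ^ k * σ) * lfKick J lam δ (lfDrift (δ / 2) ((leapfrogQPQ J lam δ)^[k] z).1
              ((leapfrogQPQ J lam δ)^[k] z).2) ((leapfrogQPQ J lam δ)^[k] z).2 y ∧
        -((-1) ^ k * σ) * lfKick J lam δ (lfDrift (δ / 2) ((leapfrogQPQ J lam δ)^[k] z).1
              ((leapfrogQPQ J lam δ)^[k] z).2) ((leapfrogQPQ J lam δ)^[k] z).2 y
          ≤ ((fun w : ℝ × ℝ × ℝ × ℝ => (δ * w.2.2.1 - w.2.1, δ * w.2.2.2,
          δ * (4 * lam * (δ * w.2.2.1 - w.2.1) ^ 3 - 2 * (∑ x, ∑ y, |J x y|) * (δ * w.2.2.2)) - w.2.2.2,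
          δ * (4 * lam * (δ * w.2.2.2) ^ 3 + 2 * (∑ x, ∑ y, |J x y|) * (δ * w.2.2.2)) + w.2.2.2))^[k] v).2.2.2) := by
  induction k with
  | zero =>
    intro σ hσ v z hu hp _
    simp only [Function.iterate_zero, id_eq, pow_zero, one_mul]
    exact ⟨hu, hp⟩
  | succ k ih =>
    intro σ hσ v z hu hp hpos
    -- the invariant after `k` steps
    have hk := ih hσ v z hu hp (fun j hj => hpos j (Nat.lt_succ_of_lt hj))
    obtain ⟨hku, hkp⟩ := hk
    obtain ⟨hka, hkb, hkab⟩ := hpos k (Nat.lt_succ_self k)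
    have hσk : (-1 : ℝ) ^ k * σ = 1 ∨ (-1 : ℝ) ^ k * σ = -1 := by
      rcases neg_one_pow_eq_or ℝ k with h | h <;> rcases hσ with h' | h' <;> rw [h, h'] <;> norm_num
    have hstep := leapfrogQPQ_stage hlam hδ hσk hka hkb hkab J ((leapfrogQPQ J lam δ)^[k] z) hku hkp
    rw [Function.iterate_succ_apply', Function.iterate_succ_apply']
    have eσ : (-1 : ℝ) ^ (k + 1) * σ = -((-1) ^ k * σ) := by rw [pow_succ]; ring
    rw [eσ]
    exact hstep

/-! ## §4 Stage zero: the far box -/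

/-- **Stage zero.**  `φ ∈ A_t`, `|p_y| ≤ t/δ`, `t ≥ 0`, `δ > 0`, `λ ≥ 0`, `t/δ + 5δtC_J ≤ δλt³/4`:
the stage invariant holds with `σ = 1` and levels `(t/2, 5t/2, δλt³/4, t/δ + δ(4λ(5t/2)³ + 2C_J(5t/2)))`. -/
theorem stage_zero_of_mem_box {lam δ t : ℝ} (hlam : 0 ≤ lam) (hδ : 0 < δ) (ht : 0 ≤ t)
    (J : Fin (n + 1) → Fin (n + 1) → ℝ) {φ p : Fin (n + 1) → ℝ}
    (hφ : ∀ y, t ≤ φ y ∧ φ y ≤ 2 * t) (hp : ∀ y, |p y| ≤ t / δ)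
    (hbig : t / δ + 5 * δ * t * (∑ x, ∑ y, |J x y|) ≤ δ * lam * t ^ 3 / 4) :
    (∀ y, t / 2 ≤ 1 * lfDrift (δ / 2) φ p y ∧ 1 * lfDrift (δ / 2) φ p y ≤ 5 * t / 2) ∧
    (∀ y, δ * lam * t ^ 3 / 4 ≤ -1 * lfKick J lam δ (lfDrift (δ / 2) φ p) p y ∧
      -1 * lfKick J lam δ (lfDrift (δ / 2) φ p) p y
        ≤ t / δ + δ * (4 * lam * (5 * t / 2) ^ 3 + 2 * (∑ x, ∑ y, |J x y|) * (5 * t / 2))) := by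
  have hmid : ∀ y, t / 2 ≤ lfDrift (δ / 2) φ p y ∧ lfDrift (δ / 2) φ p y ≤ 5 * t / 2 := by
    intro y
    unfold lfDrift
    have hpy := abs_le.mp (hp y)
    have h1 : -(t / 2) ≤ δ / 2 * p y := by
      have : δ / 2 * (-(t / δ)) ≤ δ / 2 * p y := mul_le_mul_of_nonneg_left hpy.1 (by linarith)
      have e : δ / 2 * (-(t / δ)) = -(t / 2) := by field_simp
      linarith
    have h2 : δ / 2 * p y ≤ t / 2 := by
      have : δ / 2 * p y ≤ δ / 2 * (t / δ) := mul_le_mul_of_nonneg_left hpy.2 (by linarith)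
      have e : δ / 2 * (t / δ) = t / 2 := by field_simp
      linarith
    constructor <;> linarith [(hφ y).1, (hφ y).2]
  refine ⟨fun y => by simpa only [one_mul] using hmid y, fun y => ?_⟩
  have hkick := lfKick_le_of_mem_box hlam hδ ht J hφ hp hbig y
  -- upper bound: `|p'| ≤ |p| + δ|F(u)|` with the force box of `[t/2, 5t/2]`
  have hmid' : ∀ y', t / 2 ≤ 1 * lfDrift (δ / 2) φ p y' ∧ 1 * lfDrift (δ / 2) φ p y' ≤ 5 * t / 2 :=
    fun y' => by simpa only [one_mul] using hmid y'
  have hF := latticePhi4Force_mem_of_box hlam (by linarith) (Or.inl rfl) J _ hmid' y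
  have hpy := (abs_le.mp (hp y)).1
  unfold lfKick at hkick ⊢
  rw [one_mul] at hF
  constructor
  · linarith
  · nlinarith [hF.2, hδ.le]

end Stages

end Summit.Ventures.LatticeQCDFlow.Exactness
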